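import Literature.GroupTheory.CombinatorialGroupTheory.QuadraticSystemsGluing
import Literature.GroupTheory.CombinatorialGroupTheory.QuadraticWords
import Mathlib.GroupTheory.PresentedGroup
import HarnessLib

/-!
# Gluing the faces of a system of polygons, II: the Tietze transformation and the iteration

Topic `Literature/GroupTheory/CombinatorialGroupTheory`; continues `QuadraticSystemsGluing.lean`.
A system of faces `Fs : List (List (ι × Bool))` presents the group
`⟨ι ∣ (boundary word of F), F ∈ Fs⟩` (plus extra relators `S₀`, e.g. the killed tree edges of a
Reidemeister–Schreier rewriting); gluing the faces `A y` and `C ȳ` along the edge `y` into the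
face `A C` is, on the group side, the **Tietze transformation**

  `⟨ι ∣ A·y, C·ȳ, …⟩ = ⟨ι ∣ A·C, A·y, …⟩ ≅ ⟨ι ∣ A·C, y, …⟩`

(the first equality of normal closures is elementary; the isomorphism is induced by the
transvection `y ↦ y·A⁻¹` of the free group, which fixes every word avoiding the symbol of `y`) —
Zieschang–Vogt–Coldewey, LNM 835, 3.1.6 with 2.2.4 (Tietze), 5.2.4 (related words present
isomorphic groups).  We keep the killed generator `y` in the presentation (as the relator `x_y`)
rather than shrinking the alphabet.

Main results: `normalClosure_faces_eq_of_conj` (face relators count up to conjugacy, so faces may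
be rotated), `normalClosure_faces_glue_normal_form`, and `presentedGroup_glue` — the Tietze step
above, for any extra relators avoiding the symbol of `y`.  The iteration down to one face is
`exists_one_face_of_sysPerm_transitive` (`QuadraticSystemsGluingIterate.lean`).

This is block [B2-GLUE] of the Reidemeister–Schreier computation of the finite-index subgroups of
surface groups (ZVC Thm. 4.14.22): fed with the lifted faces of a finite covering (tree edges
killed), it produces the one-vertex quadratic word whose one-relator group is a surface group
(`OneVertex.nonempty_presentedGroup_mulEquiv_surfaceGroup_of_card`).  Theorems only.

## References

* H. Zieschang, E. Vogt, H.-D. Coldewey, *Surfaces and Planar Discontinuous Groups*, LNM 835,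
  Springer 1980, 2.2.4, §3.1 (3.1.6), 5.2.4. [ZieschangVogtColdewey1980]
-/

namespace Literature.GroupTheory.CombinatorialGroupTheory

open List Equiv Equiv.Perm

variable {ι : Type*} [DecidableEq ι]

/-! ### Normal closures -/

section NormalClosure

variable {G : Type*} [Group G]

/-- Two sets of relators each contained in the normal closure of the other have the same normal
closure. [folklore] -/
private theorem normalClosure_eq_of_subset {s t : Set G} (h₁ : s ⊆ Subgroup.normalClosure t)
    (h₂ : t ⊆ Subgroup.normalClosure s) : Subgroup.normalClosure s = Subgroup.normalClosure t :=
  le_antisymm (Subgroup.normalClosure_le_normal h₁) (Subgroup.normalClosure_le_normal h₂)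

/-- A conjugate `c⁻¹ n c` of an element of a normal closure lies in it. [folklore] -/
private theorem conj_mem' {s : Set G} {n : G} (hn : n ∈ Subgroup.normalClosure s) (c : G) :
    c⁻¹ * n * c ∈ Subgroup.normalClosure s := by
  simpa using Subgroup.normalClosure_normal.conj_mem n hn c⁻¹

end NormalClosure

/-! ### Relators of a system of faces -/

section Faces

omit [DecidableEq ι] in
/-- **Face relators up to conjugacy**: if every boundary word of `Fs` is conjugate to a boundary
word of `Fs'` and conversely, the two systems (with the same extra relators) have the same normal
closure of relators. [cite: ZieschangVogtColdewey1980, 2.2.4] -/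
theorem normalClosure_faces_eq_of_conj {Fs Fs' : List (List (ι × Bool))} (R : Set (FreeGroup ι))
    (h₁ : ∀ F ∈ Fs, ∃ F' ∈ Fs', ∃ c : FreeGroup ι, FreeGroup.mk F = c * FreeGroup.mk F' * c⁻¹)
    (h₂ : ∀ F' ∈ Fs', ∃ F ∈ Fs, ∃ c : FreeGroup ι, FreeGroup.mk F' = c * FreeGroup.mk F * c⁻¹) :
    Subgroup.normalClosure ((fun F => FreeGroup.mk F) '' {F | F ∈ Fs} ∪ R) =
      Subgroup.normalClosure ((fun F => FreeGroup.mk F) '' {F | F ∈ Fs'} ∪ R) := by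
  apply normalClosure_eq_of_subset
  · rintro x (⟨F, hF, rfl⟩ | hx)
    · obtain ⟨F', hF', c, hc⟩ := h₁ F hF
      show FreeGroup.mk F ∈ Subgroup.normalClosure _
      rw [hc]
      have hm : FreeGroup.mk F' ∈ Subgroup.normalClosure ((fun F => FreeGroup.mk F) '' {F | F ∈ Fs'} ∪ R) :=
        Subgroup.subset_normalClosure (Or.inl ⟨F', hF', rfl⟩)
      exact Subgroup.normalClosure_normal.conj_mem _ hm c
    · exact Subgroup.subset_normalClosure (Or.inr hx)
  · rintro x (⟨F', hF', rfl⟩ | hx)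
    · obtain ⟨F, hF, c, hc⟩ := h₂ F' hF'
      show FreeGroup.mk F' ∈ Subgroup.normalClosure _
      rw [hc]
      have hm : FreeGroup.mk F ∈ Subgroup.normalClosure ((fun F => FreeGroup.mk F) '' {F | F ∈ Fs} ∪ R) :=
        Subgroup.subset_normalClosure (Or.inl ⟨F, hF, rfl⟩)
      exact Subgroup.normalClosure_normal.conj_mem _ hm c
    · exact Subgroup.subset_normalClosure (Or.inr hx)

omit [DecidableEq ι] in
/-- Rotating a face to put a letter last conjugates its boundary word. [cite: ZieschangVogtColdewey1980, 3.1.1] -/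
theorem exists_mk_rotate_to_last_conj (A₁ A₂ : List (ι × Bool)) (x : ι × Bool) :
    ∃ c : FreeGroup ι, FreeGroup.mk (A₁ ++ x :: A₂) = c * FreeGroup.mk ((A₂ ++ A₁) ++ [x]) * c⁻¹ := by
  refine ⟨FreeGroup.mk A₁ * FreeGroup.mk [x], ?_⟩
  rw [mk_append_eq_conj A₁ (x :: A₂), show (x :: A₂) ++ A₁ = [x] ++ (A₂ ++ A₁) by simp,
    mk_append_eq_conj [x] (A₂ ++ A₁)]
  group

omit [DecidableEq ι] in
/-- … and conversely. [cite: ZieschangVogtColdewey1980, 3.1.1] -/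
theorem exists_mk_rotate_to_last_conj' (A₁ A₂ : List (ι × Bool)) (x : ι × Bool) :
    ∃ c : FreeGroup ι, FreeGroup.mk ((A₂ ++ A₁) ++ [x]) = c * FreeGroup.mk (A₁ ++ x :: A₂) * c⁻¹ := by
  obtain ⟨c, hc⟩ := exists_mk_rotate_to_last_conj A₁ A₂ x
  exact ⟨c⁻¹, by rw [hc]; group⟩

omit [DecidableEq ι] in
/-- **The normalised system presents the same group**: the face relators of
`(A₁ y A₂) ∷ M ⧺ (C₁ ȳ C₂) ∷ N` and of `(A₂ A₁ y) ∷ (C₂ C₁ ȳ) ∷ M ⧺ N` have the same normal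
closure (together with any extra relators). [cite: ZieschangVogtColdewey1980, 2.2.4] -/
theorem normalClosure_faces_glue_normal_form (A₁ A₂ C₁ C₂ : List (ι × Bool)) (M N : List (List (ι × Bool)))
    (y : ι × Bool) (R : Set (FreeGroup ι)) :
    Subgroup.normalClosure ((fun F => FreeGroup.mk F) '' {F | F ∈ (A₁ ++ y :: A₂) :: (M ++ (C₁ ++ bar y :: C₂) :: N)} ∪ R) =
      Subgroup.normalClosure ((fun F => FreeGroup.mk F) ''
        {F | F ∈ ((A₂ ++ A₁) ++ [y]) :: ((C₂ ++ C₁) ++ [bar y]) :: (M ++ N)} ∪ R) := by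
  apply normalClosure_faces_eq_of_conj
  · intro F hF
    simp only [mem_cons, mem_append] at hF
    rcases hF with rfl | hF | rfl | hF
    · exact ⟨_, mem_cons_self, exists_mk_rotate_to_last_conj A₁ A₂ y⟩
    · exact ⟨F, mem_cons_of_mem _ (mem_cons_of_mem _ (mem_append_left _ hF)), 1, by simp⟩
    · exact ⟨_, mem_cons_of_mem _ mem_cons_self, exists_mk_rotate_to_last_conj C₁ C₂ (bar y)⟩
    · exact ⟨F, mem_cons_of_mem _ (mem_cons_of_mem _ (mem_append_right _ hF)), 1, by simp⟩
  · intro F' hF'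
    simp only [mem_cons, mem_append] at hF'
    rcases hF' with rfl | rfl | hF' | hF'
    · exact ⟨_, mem_cons_self, exists_mk_rotate_to_last_conj' A₁ A₂ y⟩
    · exact ⟨_, mem_cons_of_mem _ (mem_append_right _ mem_cons_self), exists_mk_rotate_to_last_conj' C₁ C₂ (bar y)⟩
    · exact ⟨F', mem_cons_of_mem _ (mem_append_left _ hF'), 1, by simp⟩
    · exact ⟨F', mem_cons_of_mem _ (mem_append_right _ (mem_cons_of_mem _ hF')), 1, by simp⟩

end Faces

/-! ### The Tietze transformation of one gluing -/

section Tietze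

variable {A C : List (ι × Bool)} {Gs : List (List (ι × Bool))} {y : ι × Bool}

omit [DecidableEq ι] in
/-- In the system `(A y) ∷ (C ȳ) ∷ Gs` with distinct letters, every letter with the symbol of `y`
is `y` or `ȳ`; so `A` avoids that symbol. [cite: ZieschangVogtColdewey1980, 3.1.6] -/
theorem avoids_of_glue_left (hd : ((A ++ [y]) :: (C ++ [bar y]) :: Gs).flatten.Nodup) : Avoids y.1 A := by
  intro x hx hxy
  have hx' : x ∈ ((A ++ C) :: Gs).flatten := by simp [hx]
  exact ((mem_glue_flatten_iff hd).1 hx').2 hxy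

omit [DecidableEq ι] in
/-- … and so does `C`. [cite: ZieschangVogtColdewey1980, 3.1.6] -/
theorem avoids_of_glue_right (hd : ((A ++ [y]) :: (C ++ [bar y]) :: Gs).flatten.Nodup) : Avoids y.1 C := by
  intro x hx hxy
  have hx' : x ∈ ((A ++ C) :: Gs).flatten := by simp [hx]
  exact ((mem_glue_flatten_iff hd).1 hx').2 hxy

omit [DecidableEq ι] in
/-- … and so does every other face. [cite: ZieschangVogtColdewey1980, 3.1.6] -/
theorem avoids_of_glue_rest (hd : ((A ++ [y]) :: (C ++ [bar y]) :: Gs).flatten.Nodup) {F : List (ι × Bool)}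
    (hF : F ∈ Gs) : Avoids y.1 F := by
  intro x hx hxy
  have hx' : x ∈ ((A ++ C) :: Gs).flatten := by
    rw [flatten_cons]; exact mem_append_right _ (mem_flatten.2 ⟨F, hF, hx⟩)
  exact ((mem_glue_flatten_iff hd).1 hx').2 hxy

omit [DecidableEq ι] in
/-- The boundary word of the face `A y` is `mk A · y`. [cite: ZieschangVogtColdewey1980, 3.1.1] -/
theorem mk_append_singleton (A : List (ι × Bool)) (y : ι × Bool) :
    FreeGroup.mk (A ++ [y]) = FreeGroup.mk A * sgen y.1 y.2 := by
  rw [mk_append]; rfl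

omit [DecidableEq ι] in
/-- The boundary word of the face `C ȳ` is `mk C · y⁻¹`. [cite: ZieschangVogtColdewey1980, 3.1.1] -/
theorem mk_append_singleton_bar (C : List (ι × Bool)) (y : ι × Bool) :
    FreeGroup.mk (C ++ [bar y]) = FreeGroup.mk C * (sgen y.1 y.2)⁻¹ := by
  rw [mk_append, ← sgen_fst_not]; rfl

omit [DecidableEq ι] in
/-- A generator `x_i` lies in a normal subgroup iff the signed generator `x_i^{(s)}` does. [folklore] -/
private theorem sgen_mem_iff {N : Subgroup (FreeGroup ι)} (i : ι) (s : Bool) :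
    sgen i s ∈ N ↔ FreeGroup.of i ∈ N := by
  cases s
  · rw [sgen_false]; exact N.inv_mem_iff
  · rw [sgen_true]

/-- **The Tietze transformation of a gluing** (ZVC 3.1.6 with 2.2.4 / 5.2.4): for the systems
`(A y) ∷ (C ȳ) ∷ Gs` and `(A C) ∷ Gs` (distinct letters) and any set `R` of extra relators whose
words avoid the symbol of `y`,
`⟨ι ∣ A·y, C·ȳ, Gs, R⟩ ≅ ⟨ι ∣ A·C, Gs, x_y, R⟩` — the glued edge survives as a killed generator.
[cite: ZieschangVogtColdewey1980, 3.1.6 / 2.2.4] -/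
theorem presentedGroup_glue (hd : ((A ++ [y]) :: (C ++ [bar y]) :: Gs).flatten.Nodup)
    (R : Set (FreeGroup ι)) (hR : ∀ r ∈ R, Avoids y.1 r.toWord) :
    Nonempty (PresentedGroup ((fun F => FreeGroup.mk F) '' {F | F ∈ (A ++ [y]) :: (C ++ [bar y]) :: Gs} ∪ R) ≃*
      PresentedGroup ((fun F => FreeGroup.mk F) '' {F | F ∈ (A ++ C) :: Gs} ∪ ({FreeGroup.of y.1} ∪ R))) := by
  classical
  have hA := avoids_of_glue_left hd
  have hC := avoids_of_glue_right hd
  set a := FreeGroup.mk A with ha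
  set c := FreeGroup.mk C with hc
  set g := sgen y.1 y.2 with hg
  set S₁ : Set (FreeGroup ι) := (fun F => FreeGroup.mk F) '' {F | F ∈ (A ++ [y]) :: (C ++ [bar y]) :: Gs} ∪ R
    with hS₁
  set S₂ : Set (FreeGroup ι) := insert (a * c) (insert (a * g) ((fun F => FreeGroup.mk F) '' {F | F ∈ Gs} ∪ R))
    with hS₂
  set S₃ : Set (FreeGroup ι) := (fun F => FreeGroup.mk F) '' {F | F ∈ (A ++ C) :: Gs} ∪ ({FreeGroup.of y.1} ∪ R)
    with hS₃
  -- step 1: `⟪A·y, C·ȳ, …⟫ = ⟪A·C, A·y, …⟫`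
  have h12 : Subgroup.normalClosure S₁ = Subgroup.normalClosure S₂ := by
    apply normalClosure_eq_of_subset
    · rintro x (⟨F, hF, rfl⟩ | hx)
      · show FreeGroup.mk F ∈ Subgroup.normalClosure _
        simp only [Set.mem_setOf_eq, mem_cons] at hF
        rcases hF with rfl | rfl | hF
        · rw [mk_append_singleton]
          exact Subgroup.subset_normalClosure (Set.mem_insert_of_mem _ (Set.mem_insert _ _))
        · -- `C·ȳ = a⁻¹ · ((a c) (a g)⁻¹) · a`
          rw [mk_append_singleton_bar]
          have h1 : a * c ∈ Subgroup.normalClosure S₂ := Subgroup.subset_normalClosure (Set.mem_insert _ _)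
          have h2 : a * g ∈ Subgroup.normalClosure S₂ :=
            Subgroup.subset_normalClosure (Set.mem_insert_of_mem _ (Set.mem_insert _ _))
          have h3 := conj_mem' (mul_mem h1 (inv_mem h2)) a
          have e : a⁻¹ * (a * c * (a * g)⁻¹) * a = c * g⁻¹ := by group
          rw [← hc, ← hg, ← e]; exact h3
        · exact Subgroup.subset_normalClosure
            (Set.mem_insert_of_mem _ (Set.mem_insert_of_mem _ (Or.inl ⟨F, hF, rfl⟩)))
      · exact Subgroup.subset_normalClosure
          (Set.mem_insert_of_mem _ (Set.mem_insert_of_mem _ (Or.inr hx)))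
    · rintro x hx
      show x ∈ Subgroup.normalClosure _
      simp only [hS₂, Set.mem_insert_iff, Set.mem_union, Set.mem_image, Set.mem_setOf_eq] at hx
      rcases hx with rfl | rfl | ⟨F, hF, rfl⟩ | hx
      · -- `a c = (a g) · (g⁻¹ c)`, `g⁻¹ c = c⁻¹ (c g⁻¹) c`
        have h1 : a * g ∈ Subgroup.normalClosure S₁ := by
          rw [ha, hg, ← mk_append_singleton]
          exact Subgroup.subset_normalClosure (Or.inl ⟨_, by simp, rfl⟩)
        have h2 : c * g⁻¹ ∈ Subgroup.normalClosure S₁ := by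
          rw [hc, hg, ← mk_append_singleton_bar]
          exact Subgroup.subset_normalClosure (Or.inl ⟨_, by simp, rfl⟩)
        have h3 := conj_mem' h2 c
        have e : a * c = (a * g) * (c⁻¹ * (c * g⁻¹) * c) := by group
        rw [e]; exact mul_mem h1 h3
      · rw [ha, hg, ← mk_append_singleton]
        exact Subgroup.subset_normalClosure (Or.inl ⟨_, by simp, rfl⟩)
      · exact Subgroup.subset_normalClosure (Or.inl ⟨F, by simp [hF], rfl⟩)
      · exact Subgroup.subset_normalClosure (Or.inr hx)
  -- step 2: the transvection `y ↦ y·a⁻¹`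
  let θ : MulAut (FreeGroup ι) := transv y.1 y.2 (FreeGroup.invRev A) hA.invRev
  have θ_mk : ∀ L : List (ι × Bool), Avoids y.1 L → θ (FreeGroup.mk L) = FreeGroup.mk L :=
    fun L hL => transv_mk_of_avoids _ _ _ _ hL
  have θ_R : ∀ r ∈ R, θ r = r := fun r hr => by
    rw [← FreeGroup.mk_toWord (x := r)]; exact θ_mk _ (hR r hr)
  have θ_ag : θ (a * g) = a * g * a⁻¹ := by
    rw [map_mul, ha, θ_mk A hA, hg, transv_sgen, ← FreeGroup.inv_mk, mul_assoc]
  have θ_ac : θ (a * c) = a * c := by rw [ha, hc, ← mk_append, θ_mk _ (avoids_append.2 ⟨hA, hC⟩)]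
  have h23 : Subgroup.normalClosure (θ '' S₂) = Subgroup.normalClosure S₃ := by
    apply normalClosure_eq_of_subset
    · rintro x ⟨x, hx, rfl⟩
      show θ x ∈ Subgroup.normalClosure _
      simp only [hS₂, Set.mem_insert_iff, Set.mem_union, Set.mem_image, Set.mem_setOf_eq] at hx
      rcases hx with rfl | rfl | ⟨F, hF, rfl⟩ | hx
      · rw [θ_ac, ha, hc, ← mk_append]
        exact Subgroup.subset_normalClosure (Or.inl ⟨_, by simp, rfl⟩)
      · rw [θ_ag]
        have hm : g ∈ Subgroup.normalClosure S₃ :=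
          (sgen_mem_iff y.1 y.2).2 (Subgroup.subset_normalClosure (Or.inr (Or.inl rfl)))
        exact Subgroup.normalClosure_normal.conj_mem _ hm a
      · rw [θ_mk F (avoids_of_glue_rest hd hF)]
        exact Subgroup.subset_normalClosure (Or.inl ⟨F, by simp [hF], rfl⟩)
      · rw [θ_R x hx]
        exact Subgroup.subset_normalClosure (Or.inr (Or.inr hx))
    · rintro x (⟨F, hF, rfl⟩ | hx | hx)
      · show FreeGroup.mk F ∈ Subgroup.normalClosure _
        simp only [Set.mem_setOf_eq, mem_cons] at hF
        rcases hF with rfl | hF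
        · rw [mk_append, ← ha, ← hc, ← θ_ac]
          exact Subgroup.subset_normalClosure ⟨_, Set.mem_insert _ _, rfl⟩
        · rw [← θ_mk F (avoids_of_glue_rest hd hF)]
          exact Subgroup.subset_normalClosure
            ⟨_, Set.mem_insert_of_mem _ (Set.mem_insert_of_mem _ (Or.inl ⟨F, hF, rfl⟩)), rfl⟩
      · -- `x_y`: from `θ (a g) = a g a⁻¹`
        rw [Set.mem_singleton_iff] at hx
        subst hx
        change FreeGroup.of y.1 ∈ Subgroup.normalClosure (θ '' S₂)
        rw [← sgen_mem_iff y.1 y.2, ← hg]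
        have h1 : a * g * a⁻¹ ∈ Subgroup.normalClosure (θ '' S₂) := by
          rw [← θ_ag]
          exact Subgroup.subset_normalClosure ⟨_, Set.mem_insert_of_mem _ (Set.mem_insert _ _), rfl⟩
        have e : a⁻¹ * (a * g * a⁻¹) * a = g := by group
        rw [← e]; exact conj_mem' h1 a
      · show x ∈ Subgroup.normalClosure _
        rw [← θ_R x hx]
        exact Subgroup.subset_normalClosure
          ⟨_, Set.mem_insert_of_mem _ (Set.mem_insert_of_mem _ (Or.inr hx)), rfl⟩
  -- assemble
  have e₂ : FreeGroup ι ⧸ Subgroup.normalClosure S₂ ≃* FreeGroup ι ⧸ Subgroup.normalClosure S₃ :=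
    QuotientGroup.congr (Subgroup.normalClosure S₂) (Subgroup.normalClosure S₃) θ (by
      rw [Subgroup.map_normalClosure _ _ (by exact θ.surjective), MonoidHom.coe_coe]
      exact h23)
  exact ⟨(QuotientGroup.quotientMulEquivOfEq h12).trans e₂⟩

end Tietze

end Literature.GroupTheory.CombinatorialGroupTheory
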